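import Literature.NumberTheory.Automorphic.ArchRankOneSplitConeMatchingJoint      -- ★ p850383 (F0P3a-p05 (g19)): (A0-c) JOINT `exists_tendsto_abs_sub_smul_integral_descConj_hypBlockGL_cone_joint`
import Literature.NumberTheory.Automorphic.ArchEndoscopicChartSplitDock              -- ★ p850300 (LH3-p01 (g3)): (DOCK-w₀) `chartTorusHLoc_eq_torusU`, `chartOrbHLoc_eq_of_chartTorusHLoc_eq`, `endoBlockAt_eq_mk_hypBlockGL`
import Literature.NumberTheory.Automorphic.ArchEndoscopicChartOrbLocalCongr          -- ★ p850314 (this seat): (T-CONGR) `chartOrbHLoc_eq_of_mem_iff`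
import Literature.MeasureTheory.Group.InvariantQuotientAbelian                       -- ★ `isInvInvariant_of_comm` (Haar on an abelian closed subgroup is inversion invariant)
import HarnessLib

/-!
# (A0-DOCKED-JOINT): at a SPLIT place `w ∈ S`, `|eˣ − e⁻ˣ| · chartOrbHLoc L S w ν_w (f₀ ∘ coe) (x, ·, θ) ⟶ D · [cone⁺ + cone⁻](f₀, e^{iθ₀})` as `(x, θ) → (0, θ₀)`, `x ≠ 0`
# — JOINTLY in the local chart coordinates, with ONE `D = D(w, ν_w) > 0` for all labels `S ∋ w` (Shelstad 1979 Lemma 4.3; Varadarajan 1989 §6.4 Thm 23; Rogawski 1990 §8.2)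

Topic `NumberTheory/Automorphic`; namespace `Literature.NumberTheory.Automorphic.UnitaryGroup`.  THEOREMS ONLY (no `def`, no instance, no notation, no axiom, no
`sorry`).  Cell `pub/hodgecm-mathlib`, crux H413 (`stmt-HodgeConjecture-24833`), F0∕P3c line LH3 (closer stub `stub_N9`, DIRECT ROAD), organ J; brick
**(A0-DOCKED-JOINT)** = the `hA0` slot of ★ `stOrbFamH_insert_cayPt_eq_mul_prod{,_of_continuousAt}` (LH5-p04) and of ★ `exists_hasOneSidedJump_stOrbFamH_cayPt_prod` (LH10-p02,
(J-H) §4), in the (K0±) half-cone currency; author LH10-p02 (g4).  Count-neutral.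

WHAT IS PROVED.
* §1 `measure_pos_lt_top_of_subgroup_eq` — generic: a compact set with non-empty interior of a subgroup `T`, read inside an EQUAL subgroup `T′`, has positive finite
  mass for every measure of `T′` positive on opens and finite on compacts (torus as a variable; `subst`).
* §2 **`exists_tendsto_absExpSub_mul_chartOrbHLoc_cone`** — THE HEAD: for each complex place `w` and Haar `ν_w` on `U(Φ₂)_w` there is ONE `D > 0` such that for EVERY label
  `S ∋ w`, every continuous compactly supported `f₀` on `M₂(ℂ)` and all `θ₁, θ₀`,
  `Tendsto (v ↦ |e^{v₀} − e^{−v₀}| · chartOrbHLoc L S w ν_w (f₀ ∘ coe) v) (𝓝[{v | v₀ ≠ 0}] (0, θ₁, θ₀)) (𝓝 (D · [cone⁺ + cone⁻](f₀, e^{iθ₀})))` in the TOKENS of ★ (K0±-Cayley) ∕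
  ★ `ArchBouazizStableFamilyJumpZero{,Product}` (`z = ↑(Circle.exp θ₀)`).  Assembly: ★ (T-CONGR) reduces `S` to the reference label `{w}`; ★ (DOCK-w₀) reads
  `chartOrbHLoc L {w} w` through the diagonal torus `torusU` with an inversion-invariant Haar `t` on it (`D = t(B_{w}) · C₂(ν_w ∕ t)`, positive by §1 and ★ (A0-c)) and the
  chart point as `hypBlockGL (v₀) (v₂)`; ★ (A0-c) JOINT `exists_tendsto_abs_sub_smul_integral_descConj_hypBlockGL_cone_joint` (F0P3a-p05) along `v ↦ (v₀, v₂)`.  The place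
  carrier `archLocal L 2 Φ₂ w` IS `unitaryGroupOfForm conj (σ_w Φ₂)` by definition and `σ_w Φ₂ = Φ₂` (★ `antidiagOne_map`, `StdForm.over_antidiagonal_eq`); the proof re-registers
  the instances in that spelling (★ (DOCK-w₀)'s recipe) and identifies the two readings of the quotient integral by `rfl`.
HONEST LABEL: HC_CM is proved only modulo the 7 printed citations (2 remaining: hLiu418 = `stmt-HodgeConjecture-24832`, h413 = `stmt-HodgeConjecture-24833`) until rung 0
closes; measure theory over Mathlib + ★ kit, moves no row of the books.

## References
* [Shelstad1979] D. Shelstad, *Characters and inner forms of a quasi-split group over ℝ*, Compositio Math. 39 (1979), Lemma 4.3 p. 25, §4 pp. 22–23.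
* [Varadarajan1989] V. S. Varadarajan, *An Introduction to Harmonic Analysis on Semisimple Lie Groups*, Cambridge Stud. Adv. Math. 16 (1989), §6.4 Lemma 21, Thm 23.
* [Rogawski1990] J. D. Rogawski, *Automorphic Representations of Unitary Groups in Three Variables*, Ann. of Math. Stud. 123 (1990), §3.6 p. 31, §8.2 pp. 119, 122, §8.3 p. 124.
* [DeitmarEchterhoff2014] A. Deitmar, S. Echterhoff, *Principles of Harmonic Analysis*, 2nd ed. (2014), Thm. 1.5.3.
* [Folland1995] G. B. Folland, *A Course in Abstract Harmonic Analysis* (1995), §2.2, §2.6 (2.52).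
-/

set_option autoImplicit false

noncomputable section

open MeasureTheory Measure Set Filter Topology NumberField NumberField.InfinitePlace
open scoped ENNReal NNReal ComplexConjugate Real MatrixGroups Matrix

namespace Literature.NumberTheory.Automorphic

open Literature.MeasureTheory.Group

namespace UnitaryGroup

open Literature.NumberTheory.Rogawski1990
open Literature.NumberTheory.Automorphic.UnitaryGroup.HeisRing Literature.NumberTheory.Automorphic.UnitaryGroup.LineRing

/-! ## §1 Generic: box masses read inside an equal subgroup -/

section BoxMass

/-- **A compact set with non-empty interior of a closed subgroup, read inside an EQUAL subgroup, has positive finite Haar mass** (torus as a variable: `subst`;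
Haar measures charge open sets and are finite on compacts). [cite: Folland1995, §2.2] [cite: DeitmarEchterhoff2014, Thm. 1.5.3] -/
theorem measure_pos_lt_top_of_subgroup_eq {G : Type*} [Group G] [TopologicalSpace G] [MeasurableSpace G]
    {T T' : Subgroup G} (hTT' : T = T') (A : Set ↥T) (hA : IsCompact A) (hA' : (interior A).Nonempty)
    (t' : Measure ↥T') [t'.IsOpenPosMeasure] [IsFiniteMeasureOnCompacts t'] :
    0 < t' {m : ↥T' | (m : G) ∈ ((↑) : ↥T → G) '' A} ∧ t' {m : ↥T' | (m : G) ∈ ((↑) : ↥T → G) '' A} < ⊤ := by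
  subst hTT'
  have hset : {m : ↥T | (m : G) ∈ ((↑) : ↥T → G) '' A} = A := by
    ext m
    simp only [Set.mem_setOf_eq, Set.mem_image, Subtype.val_inj, exists_eq_right]
  rw [hset]
  exact ⟨t'.measure_pos_of_nonempty_interior hA', hA.measure_lt_top⟩

end BoxMass

/-! ## §2 The head: the docked JOINT limit of `|eˣ − e⁻ˣ| · chartOrbHLoc` at a split place, ONE constant for all labels -/

section Docked

variable (L : Type) [Field L] [NumberField L] [IsCMField L] (w : {w : InfinitePlace L // IsComplex w})
  [MeasurableSpace ↥(archLocal L 2 (Matrix.of fun i j : Fin 2 => if i.val + j.val + 1 = 2 then (1 : L) else 0) w)]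
  [BorelSpace ↥(archLocal L 2 (Matrix.of fun i j : Fin 2 => if i.val + j.val + 1 = 2 then (1 : L) else 0) w)]
  (νw : Measure ↥(archLocal L 2 (Matrix.of fun i j : Fin 2 => if i.val + j.val + 1 = 2 then (1 : L) else 0) w)) [νw.IsHaarMeasure] [νw.IsMulRightInvariant]

/-- **(A0-DOCKED-JOINT) THE SPLIT `w`-FACTOR OF THE CAYLEY VALUE, IN HALF-CONE CURRENCY.**  For every complex place `w` and Haar measure `ν_w` on `U(Φ₂)_w` there is ONE
`D > 0` such that for EVERY label `S ∋ w`, every continuous compactly supported `f₀ : M₂(ℂ) → ℂ` and all `θ₁ θ₀ : ℝ`: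
`|e^{v₀} − e^{−v₀}| · chartOrbHLoc L S w ν_w (f₀ ∘ coe) v ⟶ D · [cone⁺(f₀, e^{iθ₀}) + cone⁻(f₀, e^{iθ₀})]` as `v → (0, θ₁, θ₀)` within `{v₀ ≠ 0}` — JOINTLY in the three local
coordinates (slot `1` is not read), the half-cone integrals in the tokens of ★ (K0±-Cayley) ∕ ★ (J-H) (`z = ↑(Circle.exp θ₀)`).  This is the `hA0` binder of ★
`stOrbFamH_insert_cayPt_eq_mul_prod_of_continuousAt` and of ★ `exists_hasOneSidedJump_stOrbFamH_cayPt_prod` on the product road (`ℓ₀ = D · cone`), and with ★ (N2)∕cone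
positivity the non-vanishing `ℓ₀ ≠ 0` of (N3).  (`D = t(B_{w}) · C₂(ν_w ∕ t)` for any inversion-invariant Haar `t` of the diagonal torus — ★ (T-CONGR), ★ (DOCK-w₀), §1, §2.)
[cite: Shelstad1979, Lemma 4.3 p. 25; §4 pp. 22–23] [cite: Varadarajan1989, §6.4 Thm 23] [cite: Rogawski1990, §8.2 pp. 119, 122; §8.3 p. 124] [cite: DeitmarEchterhoff2014, Thm. 1.5.3] -/
theorem exists_tendsto_absExpSub_mul_chartOrbHLoc_cone :
    ∃ D : ℝ, 0 < D ∧ ∀ (S : Finset {w : InfinitePlace L // IsComplex w}), w ∈ S →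
      ∀ (f₀ : Matrix (Fin 2) (Fin 2) ℂ → ℂ), Continuous f₀ → HasCompactSupport f₀ → ∀ θ₁ θ₀ : ℝ,
        Tendsto (fun v : Fin 3 → ℝ => (((|Real.exp (v 0) - Real.exp (-v 0)| : ℝ) : ℂ) *
            chartOrbHLoc L S w νw (fun g => f₀ ((g : GL (Fin 2) ℂ) : Matrix (Fin 2) (Fin 2) ℂ)) v))
          (𝓝[{v : Fin 3 → ℝ | v 0 ≠ 0}] ![0, θ₁, θ₀])
          (𝓝 (((D : ℝ) : ℂ) * ((∫ p in Ioi (0 : ℝ) ×ˢ Ioc (0 : ℝ) (2 * π),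
                f₀ ((!![(1 : ℂ), 1; 1, -1] : Matrix (Fin 2) (Fin 2) ℂ) *
                  (((Circle.exp θ₀ : Circle) : ℂ) • (1 : Matrix (Fin 2) (Fin 2) ℂ) +
                    p.1 • Matrix.diagonal ![((Circle.exp θ₀ : Circle) : ℂ) * Complex.I, -(((Circle.exp θ₀ : Circle) : ℂ) * Complex.I)] +
                    p.1 • !![(0 : ℂ), -(((Circle.exp θ₀ : Circle) : ℂ) * Complex.I) * Complex.exp (-((p.2 : ℂ) * Complex.I));
                      (((Circle.exp θ₀ : Circle) : ℂ) * Complex.I) * Complex.exp ((p.2 : ℂ) * Complex.I), 0]) *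
                  !![(1 / 2 : ℂ), 1 / 2; 1 / 2, -(1 / 2)])) +
              ∫ p in Ioi (0 : ℝ) ×ˢ Ioc (0 : ℝ) (2 * π),
                f₀ ((!![(1 : ℂ), 1; 1, -1] : Matrix (Fin 2) (Fin 2) ℂ) *
                  (((Circle.exp θ₀ : Circle) : ℂ) • (1 : Matrix (Fin 2) (Fin 2) ℂ) +
                    p.1 • Matrix.diagonal ![-(((Circle.exp θ₀ : Circle) : ℂ) * Complex.I), ((Circle.exp θ₀ : Circle) : ℂ) * Complex.I] +
                    p.1 • !![(0 : ℂ), (((Circle.exp θ₀ : Circle) : ℂ) * Complex.I) * Complex.exp (-((p.2 : ℂ) * Complex.I));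
                      -(((Circle.exp θ₀ : Circle) : ℂ) * Complex.I) * Complex.exp ((p.2 : ℂ) * Complex.I), 0]) *
                  !![(1 / 2 : ℂ), 1 / 2; 1 / 2, -(1 / 2)])))) := by
  haveI : Fact (0 < 2 * π) := ⟨Real.two_pi_pos⟩
  haveI := locallyCompactSpace_archLocal_two L w
  haveI := secondCountableTopology_archLocal_two L w
  -- `U(Φ₂)_w` is BY DEFINITION `U(conj, σ_w Φ₂)(ℂ)` and `σ_w Φ₂ = Φ₂`; work in that spelling (instances re-registered there, ★ (DOCK-w₀) recipe)
  have hJ : ((Matrix.of fun i j : Fin 2 => if i.val + j.val + 1 = 2 then (1 : L) else 0).map w.1.embedding) = (StdForm.antidiagonal 2).over ℂ := by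
    rw [Literature.NumberTheory.Rogawski1990.antidiagOne_map, StdForm.over_antidiagonal_eq]
  letI iG : MeasurableSpace ↥(unitaryGroupOfForm (starRingEnd ℂ) ((Matrix.of fun i j : Fin 2 => if i.val + j.val + 1 = 2 then (1 : L) else 0).map w.1.embedding)) := ‹MeasurableSpace ↥(archLocal L 2 (Matrix.of fun i j : Fin 2 => if i.val + j.val + 1 = 2 then (1 : L) else 0) w)›
  haveI : BorelSpace ↥(unitaryGroupOfForm (starRingEnd ℂ) ((Matrix.of fun i j : Fin 2 => if i.val + j.val + 1 = 2 then (1 : L) else 0).map w.1.embedding)) := ‹BorelSpace ↥(archLocal L 2 (Matrix.of fun i j : Fin 2 => if i.val + j.val + 1 = 2 then (1 : L) else 0) w)›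
  haveI : LocallyCompactSpace ↥(unitaryGroupOfForm (starRingEnd ℂ) ((Matrix.of fun i j : Fin 2 => if i.val + j.val + 1 = 2 then (1 : L) else 0).map w.1.embedding)) := locallyCompactSpace_unitaryGroupOfForm_complex _
  haveI : SecondCountableTopology ↥(unitaryGroupOfForm (starRingEnd ℂ) ((Matrix.of fun i j : Fin 2 => if i.val + j.val + 1 = 2 then (1 : L) else 0).map w.1.embedding)) := secondCountableTopology_unitaryGroupOfForm_complex _
  let νw' : Measure ↥(unitaryGroupOfForm (starRingEnd ℂ) ((Matrix.of fun i j : Fin 2 => if i.val + j.val + 1 = 2 then (1 : L) else 0).map w.1.embedding)) := νw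
  haveI : νw'.IsHaarMeasure := ‹νw.IsHaarMeasure›
  haveI : νw'.IsMulRightInvariant := ‹νw.IsMulRightInvariant›
  -- the diagonal torus `T = torusU`: closed, abelian, with an inversion-invariant Haar measure `t`
  have hTc : IsClosed ((torusU (starRingEnd ℂ) ((Matrix.of fun i j : Fin 2 => if i.val + j.val + 1 = 2 then (1 : L) else 0).map w.1.embedding) : Subgroup ↥(unitaryGroupOfForm (starRingEnd ℂ) ((Matrix.of fun i j : Fin 2 => if i.val + j.val + 1 = 2 then (1 : L) else 0).map w.1.embedding))) : Set ↥(unitaryGroupOfForm (starRingEnd ℂ) ((Matrix.of fun i j : Fin 2 => if i.val + j.val + 1 = 2 then (1 : L) else 0).map w.1.embedding))) := isClosed_torusU_two _ _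
  haveI : LocallyCompactSpace ↥(torusU (starRingEnd ℂ) ((Matrix.of fun i j : Fin 2 => if i.val + j.val + 1 = 2 then (1 : L) else 0).map w.1.embedding)) := hTc.isClosedEmbedding_subtypeVal.locallyCompactSpace
  haveI : SecondCountableTopology ↥(torusU (starRingEnd ℂ) ((Matrix.of fun i j : Fin 2 => if i.val + j.val + 1 = 2 then (1 : L) else 0).map w.1.embedding)) := TopologicalSpace.Subtype.secondCountableTopology _
  haveI : BorelSpace ↥(torusU (starRingEnd ℂ) ((Matrix.of fun i j : Fin 2 => if i.val + j.val + 1 = 2 then (1 : L) else 0).map w.1.embedding)) := Subtype.borelSpace _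
  set t : Measure ↥(torusU (starRingEnd ℂ) ((Matrix.of fun i j : Fin 2 => if i.val + j.val + 1 = 2 then (1 : L) else 0).map w.1.embedding)) := Measure.haar with ht
  haveI : t.IsInvInvariant :=
    Literature.MeasureTheory.Group.isInvInvariant_of_comm _ hTc (fun x hx y hy => LineRing.forall_mem_torusU_comm (starRingEnd ℂ) _ hy x hx) t
  -- the quotient `U(Φ₂)_w ⧸ T`, Borel, and the quotient measure `ν_w ∕ t`: invariant, Radon, non-zero
  letI iQ : MeasurableSpace (↥(unitaryGroupOfForm (starRingEnd ℂ) ((Matrix.of fun i j : Fin 2 => if i.val + j.val + 1 = 2 then (1 : L) else 0).map w.1.embedding)) ⧸ torusU (starRingEnd ℂ) ((Matrix.of fun i j : Fin 2 => if i.val + j.val + 1 = 2 then (1 : L) else 0).map w.1.embedding)) := borel _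
  haveI iQB : BorelSpace (↥(unitaryGroupOfForm (starRingEnd ℂ) ((Matrix.of fun i j : Fin 2 => if i.val + j.val + 1 = 2 then (1 : L) else 0).map w.1.embedding)) ⧸ torusU (starRingEnd ℂ) ((Matrix.of fun i j : Fin 2 => if i.val + j.val + 1 = 2 then (1 : L) else 0).map w.1.embedding)) := ⟨rfl⟩
  haveI : SMulInvariantMeasure ↥(unitaryGroupOfForm (starRingEnd ℂ) ((Matrix.of fun i j : Fin 2 => if i.val + j.val + 1 = 2 then (1 : L) else 0).map w.1.embedding)) (↥(unitaryGroupOfForm (starRingEnd ℂ) ((Matrix.of fun i j : Fin 2 => if i.val + j.val + 1 = 2 then (1 : L) else 0).map w.1.embedding)) ⧸ torusU (starRingEnd ℂ) ((Matrix.of fun i j : Fin 2 => if i.val + j.val + 1 = 2 then (1 : L) else 0).map w.1.embedding)) (quotientMeasure (torusU (starRingEnd ℂ) ((Matrix.of fun i j : Fin 2 => if i.val + j.val + 1 = 2 then (1 : L) else 0).map w.1.embedding)) t hTc νw') := smulInvariantMeasure_quotientMeasure (torusU (starRingEnd ℂ) ((Matrix.of fun i j : Fin 2 => if i.val + j.val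 + 1 = 2 then (1 : L) else 0).map w.1.embedding)) t hTc νw'
  have hμ : (quotientMeasure (torusU (starRingEnd ℂ) ((Matrix.of fun i j : Fin 2 => if i.val + j.val + 1 = 2 then (1 : L) else 0).map w.1.embedding)) t hTc νw') ≠ 0 := quotientMeasure_ne_zero (torusU (starRingEnd ℂ) ((Matrix.of fun i j : Fin 2 => if i.val + j.val + 1 = 2 then (1 : L) else 0).map w.1.embedding)) t hTc νw'
  haveI hreg : (quotientMeasure (torusU (starRingEnd ℂ) ((Matrix.of fun i j : Fin 2 => if i.val + j.val + 1 = 2 then (1 : L) else 0).map w.1.embedding)) t hTc νw').Regular := regular_quotientMeasure (torusU (starRingEnd ℂ) ((Matrix.of fun i j : Fin 2 => if i.val + j.val + 1 = 2 then (1 : L) else 0).map w.1.embedding)) t hTc νw'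
  haveI : IsFiniteMeasureOnCompacts (quotientMeasure (torusU (starRingEnd ℂ) ((Matrix.of fun i j : Fin 2 => if i.val + j.val + 1 = 2 then (1 : L) else 0).map w.1.embedding)) t hTc νw') := hreg.toIsFiniteMeasureOnCompacts
  -- §1: the joint cone limit on the quotient
  obtain ⟨C₂, hC₂, hcone⟩ := exists_tendsto_abs_sub_smul_integral_descConj_hypBlockGL_cone_joint hJ (quotientMeasure (torusU (starRingEnd ℂ) ((Matrix.of fun i j : Fin 2 => if i.val + j.val + 1 = 2 then (1 : L) else 0).map w.1.embedding)) t hTc νw') hμ (E := ℂ)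
  -- §2: the box of the reference label `{w}` read inside `torusU` has positive finite `t`-mass
  have hw1 : w ∈ ({w} : Finset {w : InfinitePlace L // IsComplex w}) := Finset.mem_singleton_self w
  -- the same Haar measure `t`, typed over the torus as a subgroup of `U(Φ₂)_w` in the `archLocal` spelling (★ (DOCK-w₀)'s frame)
  let TAL : Subgroup ↥(archLocal L 2 (Matrix.of fun i j : Fin 2 => if i.val + j.val + 1 = 2 then (1 : L) else 0) w) := torusU (starRingEnd ℂ) ((Matrix.of fun i j : Fin 2 => if i.val + j.val + 1 = 2 then (1 : L) else 0).map w.1.embedding)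
  let tAL : Measure ↥TAL := t
  haveI : tAL.IsHaarMeasure := (inferInstance : t.IsHaarMeasure)
  haveI : tAL.IsInvInvariant := ‹t.IsInvInvariant›
  letI iQ' : MeasurableSpace (↥(archLocal L 2 (Matrix.of fun i j : Fin 2 => if i.val + j.val + 1 = 2 then (1 : L) else 0) w) ⧸ TAL) := iQ
  haveI : BorelSpace (↥(archLocal L 2 (Matrix.of fun i j : Fin 2 => if i.val + j.val + 1 = 2 then (1 : L) else 0) w) ⧸ TAL) := iQB
  obtain ⟨hBpos, hBfin⟩ := measure_pos_lt_top_of_subgroup_eq (T' := TAL) (chartTorusHLoc_eq_torusU L {w} hw1) (chartBoxImgLoc L {w} w)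
    (isCompact_chartBoxImgLoc L {w} w) (nonempty_interior_chartBoxImgLoc L {w} w) tAL
  have hD : 0 < (tAL {m : ↥TAL | (m : ↥(archLocal L 2 (Matrix.of fun i j : Fin 2 => if i.val + j.val + 1 = 2 then (1 : L) else 0) w)) ∈ ((↑) : ↥(chartTorusHLoc L {w} w) → ↥(archLocal L 2 (Matrix.of fun i j : Fin 2 => if i.val + j.val + 1 = 2 then (1 : L) else 0) w)) '' chartBoxImgLoc L {w} w}).toReal := ENNReal.toReal_pos hBpos.ne' hBfin.ne
  refine ⟨(tAL {m : ↥TAL | (m : ↥(archLocal L 2 (Matrix.of fun i j : Fin 2 => if i.val + j.val + 1 = 2 then (1 : L) else 0) w)) ∈ ((↑) : ↥(chartTorusHLoc L {w} w) → ↥(archLocal L 2 (Matrix.of fun i j : Fin 2 => if i.val + j.val + 1 = 2 then (1 : L) else 0) w)) '' chartBoxImgLoc L {w} w}).toReal * C₂, mul_pos hD hC₂, fun S hw f₀ hf₀ hf₀c θ₁ θ₀ => ?_⟩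
  -- ★ (T-CONGR): the label enters only through `w ∈ S`; reduce to the reference label `{w}`
  have hS : ∀ v : Fin 3 → ℝ, chartOrbHLoc L S w νw (fun g => f₀ ((g : GL (Fin 2) ℂ) : Matrix (Fin 2) (Fin 2) ℂ)) v = chartOrbHLoc L {w} w νw (fun g => f₀ ((g : GL (Fin 2) ℂ) : Matrix (Fin 2) (Fin 2) ℂ)) v := fun v =>
    chartOrbHLoc_eq_of_mem_iff L w νw (S := S) (S' := {w}) (by rw [Finset.mem_singleton]; exact ⟨fun _ => rfl, fun _ => hw⟩) _ v
  -- ★ (DOCK-w₀): read `chartOrbHLoc L {w} w` through `torusU`, the chart point being `hypBlockGL (v 0) (v 2)`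
  have hdock : ∀ v : Fin 3 → ℝ, chartOrbHLoc L {w} w νw (fun g => f₀ ((g : GL (Fin 2) ℂ) : Matrix (Fin 2) (Fin 2) ℂ)) v =
      ((tAL {m : ↥TAL | (m : ↥(archLocal L 2 (Matrix.of fun i j : Fin 2 => if i.val + j.val + 1 = 2 then (1 : L) else 0) w)) ∈ ((↑) : ↥(chartTorusHLoc L {w} w) → ↥(archLocal L 2 (Matrix.of fun i j : Fin 2 => if i.val + j.val + 1 = 2 then (1 : L) else 0) w)) '' chartBoxImgLoc L {w} w}).toReal : ℂ) *
        ∫ y, descConj (⟨hypBlockGL (v 0) (v 2), hypBlockGL_mem_of_eq_over hJ (v 0) (v 2)⟩ : ↥(unitaryGroupOfForm (starRingEnd ℂ) ((Matrix.of fun i j : Fin 2 => if i.val + j.val + 1 = 2 then (1 : L) else 0).map w.1.embedding))) (torusU (starRingEnd ℂ) ((Matrix.of fun i j : Fin 2 => if i.val + j.val + 1 = 2 then (1 : L) else 0).map w.1.embedding))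
            (LineRing.forall_mem_torusU_comm (starRingEnd ℂ) _ (hypBlockGL_mem_torusU hJ (v 0) (v 2))) (fun g => f₀ ((g : GL (Fin 2) ℂ) : Matrix (Fin 2) (Fin 2) ℂ)) y ∂(quotientMeasure (torusU (starRingEnd ℂ) ((Matrix.of fun i j : Fin 2 => if i.val + j.val + 1 = 2 then (1 : L) else 0).map w.1.embedding)) t hTc νw') := by
    intro v
    rw [chartOrbHLoc_eq_of_chartTorusHLoc_eq L {w} w νw (T := TAL) (chartTorusHLoc_eq_torusU L {w} hw1) hTc (iT := iQ') tAL _ v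
      (LineRing.forall_mem_torusU_comm (starRingEnd ℂ) _ ((chartTorusHLoc_eq_torusU L {w} hw1) ▸ endoBlockAt_mem_chartTorusHLoc L {w} w v))]
    have hfun : descConj (endoBlockAt L {w} w v) TAL
          (LineRing.forall_mem_torusU_comm (starRingEnd ℂ) _ ((chartTorusHLoc_eq_torusU L {w} hw1) ▸ endoBlockAt_mem_chartTorusHLoc L {w} w v)) (fun g => f₀ ((g : GL (Fin 2) ℂ) : Matrix (Fin 2) (Fin 2) ℂ)) =
        descConj (⟨hypBlockGL (v 0) (v 2), hypBlockGL_mem_archLocal L w (v 0) (v 2)⟩ : ↥(archLocal L 2 (Matrix.of fun i j : Fin 2 => if i.val + j.val + 1 = 2 then (1 : L) else 0) w)) TAL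
          (fun m hm => LineRing.forall_mem_torusU_comm (starRingEnd ℂ) _ (hypBlockGL_mem_torusU hJ (v 0) (v 2)) m hm) (fun g => f₀ ((g : GL (Fin 2) ℂ) : Matrix (Fin 2) (Fin 2) ℂ)) := by
      funext y
      induction y using QuotientGroup.induction_on with
      | H g => rw [descConj_mk, descConj_mk, endoBlockAt_eq_mk_hypBlockGL L {w} hw1 v]
    rw [hfun]
    rfl
  simp_rw [hS, hdock]
  -- §1 along `v ↦ (v 0, v 2)`
  have hφ : Tendsto (fun v : Fin 3 → ℝ => (v 0, v 2)) (𝓝[{v : Fin 3 → ℝ | v 0 ≠ 0}] ![0, θ₁, θ₀]) (𝓝[{xθ : ℝ × ℝ | xθ.1 ≠ 0}] ((0 : ℝ), θ₀)) := by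
    have hc : Continuous fun v : Fin 3 → ℝ => (v 0, v 2) := (continuous_apply 0).prodMk (continuous_apply 2)
    have h0 : ((fun v : Fin 3 → ℝ => (v 0, v 2)) ![0, θ₁, θ₀]) = ((0 : ℝ), θ₀) := by
      simp only [Matrix.cons_val_zero, Matrix.cons_val_two, Matrix.tail_cons, Matrix.head_cons]
    rw [← h0]
    exact hc.continuousWithinAt.tendsto_nhdsWithin (fun v hv => hv)
  have key := ((hcone f₀ hf₀ hf₀c θ₀).comp hφ).const_mul ((tAL {m : ↥TAL | (m : ↥(archLocal L 2 (Matrix.of fun i j : Fin 2 => if i.val + j.val + 1 = 2 then (1 : L) else 0) w)) ∈ ((↑) : ↥(chartTorusHLoc L {w} w) → ↥(archLocal L 2 (Matrix.of fun i j : Fin 2 => if i.val + j.val + 1 = 2 then (1 : L) else 0) w)) '' chartBoxImgLoc L {w} w}).toReal : ℂ)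
  rw [Complex.real_smul, ← mul_assoc, ← Complex.ofReal_mul] at key
  simp only [← Circle.coe_exp] at key
  refine key.congr fun v => ?_
  simp only [Function.comp_apply, Complex.real_smul]
  ring

end Docked

end UnitaryGroup

end Literature.NumberTheory.Automorphic

end
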